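import Literature.Topology.FourManifolds.PointPushDiffeotopy
import Literature.Topology.FourManifolds.SurgeredMappingTorus
import Literature.AlgebraicTopology.FundamentalGroup.IsotopyTrack
import HarnessLib

/-!
# Point pushing: identity on a whole disc at the end, and loops avoiding a disc

Topic `Literature/Topology/FourManifolds` (fact seat
`provefact-Literature.Topology.FourManifolds.lauden-f709dd520c`, Laudenbach–Poénaru's Lemma 2;
sequel of `PointPushDiffeotopy.lean`).  Everything here is **proved**; no definitions, no named facts.

The handle-extension step of the tree (`HandleConjugation.lean`, field `hfeet` of
`Literature.Topology.FourManifolds.HandlePair`) wants the seed diffeomorphism to be the identity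
on the whole feet tubes, i.e. on prescribed closed discs of the level, not only near their
centres; and the loop dragging one foot must miss the other (closed) foot disc.  Both upgrades
of `exists_diffeotopy_pointPush` / `Path.exists_homotopic_range_subset_disjoint_finset` are
obtained by conjugating with the tree's ambient disc contractions
(`exists_isCompactlyDiffeotopicToIdIn_apply_disc_eq_disc_smul`: `K (i y) = i (ρ y)` for `‖y‖ ≤ 1`,
`K` compactly diffeotopic to the identity inside `range i`):

* (the stagewise conjugate `K⁻¹ ∘ D_t ∘ K` of a diffeotopy is the tree's `Diffeotopy.conj`,
  `SurgeredMappingTorus.lean`);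
* `Path.Homotopic.symm_trans_map_trans_of_homotopy` — if `F : f ≃ g` is a homotopy and the track
  of `x`, closed up by a path `q : g x ⟶ f x`, is null-homotopic, then `q⁻¹ · (g ∘ p) · q ≃ f ∘ p`
  for every loop `p` at `x` (Hatcher, Lemma 1.19 with a null-homotopic track);
* `exists_diffeotopy_pointPush_closedBall` — **point pushing around a loop ending with the
  identity on the whole unit disc `i(B̄(0, 1))`**, track still homotopic to the loop;
* `Path.exists_homotopic_disjoint_image_closedBall` — a path missing the centre of a disc `i`
  and with end points off `range i` is homotopic rel end points to a path missing `i(B̄(0, 1))`,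
  changed only inside `range i`.

## References

* M. W. Hirsch, *Differential Topology*, GTM 33 (1976), Ch. 8 §1, Thm. 1.3; Ch. 8 §3, Thm. 3.1
  (shrinking discs). [HirschDT1976]
* A. Hatcher, *Algebraic Topology* (2002), Lemma 1.19. [HatcherAT2002]
-/

open scoped Manifold ContDiff Topology unitInterval
open Set Function Filter Metric Module
open Literature.AlgebraicTopology.FundamentalGroup

noncomputable section

namespace Literature.Topology.FourManifolds

/-! ### Maps homotopic through a null-homotopic track act trivially on loops -/

section Track

variable {X Y : Type*} [TopologicalSpace X] [TopologicalSpace Y]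

/-- Conjugating a loop by a (cast) constant path gives back the loop, up to homotopy.
[folklore] -/
theorem Path.Homotopic.symm_trans_trans_refl_cast {x y : Y} (e : y = x) (P : Path y y) :
    (((Path.refl x).cast e rfl).symm.trans (P.trans ((Path.refl x).cast e rfl))).Homotopic
      (P.cast e.symm e.symm) := by
  subst e
  rw [Path.cast_rfl_rfl, Path.cast_rfl_rfl, Path.refl_symm]
  exact ⟨(Path.Homotopy.reflTrans _).trans (Path.Homotopy.transRefl P)⟩

/-- **A homotopy with null-homotopic track acts trivially on loops** (Hatcher (2002), Lemma 1.19: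
`g_* = β_h f_*` with `h` the track of the base point; here `β_h` is trivial).  Let `F : f ≃ g` be
a homotopy, `x ∈ X`, and `q` a path from `g x` back to `f x` such that the closed-up track
`F(·, x) · q` is null-homotopic.  Then for every loop `p` at `x`, `q⁻¹ · (g ∘ p) · q ≃ f ∘ p` rel
end points. [cite: HatcherAT2002, Lemma 1.19] -/
theorem Path.Homotopic.symm_trans_map_trans_of_homotopy {f g : C(X, Y)} (F : f.Homotopy g) {x : X}
    (p : Path x x) (q : Path (g x) (f x))
    (hq : ((F.evalAt x).trans q).Homotopic (Path.refl (f x))) :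
    (q.symm.trans ((p.map (map_continuous g)).trans q)).Homotopic (p.map (map_continuous f)) := by
  rw [← Path.Homotopic.Quotient.eq, Path.Homotopic.Quotient.mk_trans, Path.Homotopic.Quotient.mk_trans,
    Path.Homotopic.Quotient.mk_symm, IsotopyTrack.mk_map_eq_of_homotopy F p]
  have hq' : (Path.Homotopic.Quotient.mk (F.evalAt x)).trans (Path.Homotopic.Quotient.mk q) =
      Path.Homotopic.Quotient.refl (f x) := by
    rw [← Path.Homotopic.Quotient.mk_trans, ← Path.Homotopic.Quotient.mk_refl]
    exact Path.Homotopic.Quotient.eq.2 hq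
  set τ := Path.Homotopic.Quotient.mk (F.evalAt x)
  set Q := Path.Homotopic.Quotient.mk q
  set Pf := Path.Homotopic.Quotient.mk (p.map (map_continuous f))
  -- `Q⁻¹ · ((τ⁻¹ · Pf) · τ) · Q = (τ · Q)⁻¹ · Pf · (τ · Q) = Pf`
  have hQ : Q = τ.symm := by
    have h : τ.symm.trans (τ.trans Q) = τ.symm.trans (Path.Homotopic.Quotient.refl (f x)) := by
      rw [hq']
    rwa [IsotopyTrack.quotient_symm_trans_trans, Path.Homotopic.Quotient.trans_refl] at h
  rw [hQ, IsotopyTrack.quotient_symm_symm, Path.Homotopic.Quotient.trans_assoc,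
    Path.Homotopic.Quotient.trans_assoc, Path.Homotopic.Quotient.trans_symm,
    Path.Homotopic.Quotient.trans_refl, IsotopyTrack.quotient_trans_symm_trans]

end Track

/-! ### Point pushing ending with the identity on the whole disc -/

section Disc

variable {n : ℕ}

/-- Local notation: `𝔼 n` is the model Euclidean space `EuclideanSpace ℝ (Fin n)`. -/
local notation "𝔼 " n:arg => EuclideanSpace ℝ (Fin n)

variable {M : Type*} [TopologicalSpace M] [T2Space M] [ChartedSpace (𝔼 n) M]
  [IsManifold (𝓡 n) ∞ M]

omit [T2Space M] [IsManifold (𝓡 n) ∞ M] in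
/-- A diffeomorphism which is the identity off `K` maps `K` into itself, and so does its inverse.
[folklore] -/
theorem Diffeomorph.mem_and_symm_mem_of_forall_eq_self {K : Set M} {P : M ≃ₘ⟮𝓡 n, 𝓡 n⟯ M}
    (hP : ∀ x, x ∉ K → P x = x) {x : M} (hx : x ∈ K) : P x ∈ K ∧ P.symm x ∈ K := by
  constructor
  · by_contra h
    have h1 : P (P x) = P x := hP _ h
    exact h (by rw [P.injective h1]; exact hx)
  · by_contra h
    have h1 : P (P.symm x) = P.symm x := hP _ h
    rw [P.apply_symm_apply] at h1
    exact h (by rw [← h1]; exact hx)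

/-- **Point pushing around a loop, ending with the identity on the whole unit disc.**  Let
`i : ℝⁿ → M` be a disc of a Hausdorff smooth `n`-manifold preserving the orientations
`(o₀, oM)`, `U ⊇ range i` open, and `γ` a loop at `i 0` inside `U`.  Then there is a diffeotopy
`D` of `M`, all of whose stages are the identity off a compact `K ⊆ U`, with
`D₁ (i y) = i y` **for all `‖y‖ ≤ 1`**, and whose track `t ↦ D_t (i 0)` is homotopic to `γ` rel
end points.  Proof: conjugate the diffeotopy of `exists_diffeotopy_pointPush` (identity on
`i(B̄(0, ε))`) by the ambient contraction `K`, `K (i y) = i (ε y)`, of the tree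
(`exists_isCompactlyDiffeotopicToIdIn_apply_disc_eq_disc_smul`); the new track is `K⁻¹` of the
old one, homotopic to it because `K⁻¹ ≃ id` through a diffeotopy supported in the ball
`range i`, whose track of `i 0` is null-homotopic there
(`Path.Homotopic.symm_trans_map_trans_of_homotopy`).
[cite: HirschDT1976, Ch. 8 §1, Thm. 1.3; Ch. 8 §3, Thm. 3.1] -/
theorem exists_diffeotopy_pointPush_closedBall {o₀ : Orientation ℝ (𝔼 n) (Fin (finrank ℝ (𝔼 n)))}
    {oM : SmoothOrientation (𝓡 n) M} {i : 𝔼 n → M}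
    (hi : Manifold.IsSmoothEmbedding 𝓘(ℝ, 𝔼 n) (𝓡 n) ∞ i)
    (ho : IsOrientationPreserving (SmoothOrientation.modelSpace o₀) oM i)
    {U : Set M} (hU : IsOpen U) (hiU : range i ⊆ U) (γ : Path (i 0) (i 0))
    (hγU : range γ ⊆ U) :
    ∃ (D : Diffeotopy (𝓡 n) M) (K : Set M), IsCompact K ∧ K ⊆ U ∧
      (∀ t z, z ∉ K → D.toFun t z = z) ∧
      (∀ y : 𝔼 n, ‖y‖ ≤ 1 → D.toFun 1 (i y) = i y) ∧
      ∃ h1 : D.toFun 1 (i 0) = i 0, ((D.trackPath (i 0)).cast rfl h1.symm).Homotopic γ := by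
  obtain ⟨D, K, hKc, hKU, hS, ⟨ε, hε, hDε⟩, h1, hhom⟩ := exists_diffeotopy_pointPush hi ho hU hiU γ hγU
  -- the ambient contraction `Kc (i y) = i (ε y)` supported in `range i`
  obtain ⟨Kc, hKcd, hKci⟩ :=
    exists_isCompactlyDiffeotopicToIdIn_apply_disc_eq_disc_smul hi hε (subset_refl (range i))
  obtain ⟨E, K₂, hK₂c, hK₂i, hE1, hEK⟩ := hKcd
  have hE1' : ∀ x, E.toFun 1 x = Kc x := fun x => by rw [← Diffeotopy.coe_stage, hE1]
  have hKcfix : ∀ x, x ∉ K₂ → Kc x = x := fun x hx => by rw [← hE1', hEK 1 x hx]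
  have hKc0 : Kc (i 0) = i 0 := by
    have h := hKci 0 (by simp)
    rwa [smul_zero] at h
  have hKc0' : Kc.symm (i 0) = i 0 := by
    conv_lhs => rw [← hKc0]
    exact Kc.symm_apply_apply _
  -- `Kc` and `Kc⁻¹` preserve `range i` and `U`
  have hKcU : ∀ x ∈ U, Kc x ∈ U ∧ Kc.symm x ∈ U := by
    intro x hx
    by_cases hxK : x ∈ K₂
    · obtain ⟨ha, hb⟩ := Diffeomorph.mem_and_symm_mem_of_forall_eq_self hKcfix hxK
      exact ⟨hiU (hK₂i ha), hiU (hK₂i hb)⟩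
    · have h := hKcfix x hxK
      have h' : Kc.symm x = x := by conv_lhs => rw [← h]; exact Kc.symm_apply_apply _
      exact ⟨by rw [h]; exact hx, by rw [h']; exact hx⟩
  -- the conjugate diffeotopy
  set D' := D.conj Kc with hD'
  have hD't : ∀ t z, D'.toFun t z = Kc.symm (D.toFun t (Kc z)) := fun t z => rfl
  have h1' : D'.toFun 1 (i 0) = i 0 := by rw [hD't, hKc0, h1, hKc0']
  refine ⟨D', Kc.symm '' K, hKc.image Kc.symm.continuous, ?_, fun t z hz => ?_, fun y hy => ?_, h1', ?_⟩
  · rintro _ ⟨w, hw, rfl⟩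
    exact (hKcU w (hKU hw)).2
  · have hz' : Kc z ∉ K := fun h => hz ⟨Kc z, h, Kc.symm_apply_apply z⟩
    rw [hD't, hS t _ hz', Kc.symm_apply_apply]
  · rw [hD't, hKci y hy, hDε (ε • y) ?_, ← hKci y hy, Kc.symm_apply_apply]
    rw [norm_smul, Real.norm_of_nonneg hε.le]
    calc ε * ‖y‖ ≤ ε * 1 := by gcongr
      _ = ε := mul_one ε
  · -- the track is `Kc⁻¹` of the old track; `Kc⁻¹ ≃ id` with null-homotopic track of `i 0`
    set T : Path (i 0) (i 0) := (D.trackPath (i 0)).cast rfl h1.symm with hT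
    let g : C(M, M) := ⟨Kc.symm, Kc.symm.continuous⟩
    let F : ContinuousMap.Homotopy (ContinuousMap.id M) g :=
      { toFun := fun x => E.invFun x.1 x.2
        continuous_toFun := E.contMDiff_uncurry_invFun.continuous.comp
          ((continuous_subtype_val.comp continuous_fst).prodMk continuous_snd)
        map_zero_left := fun y => by
          show E.invFun ((0 : I) : ℝ) y = y
          rw [Set.Icc.coe_zero, E.invFun_zero]; rfl
        map_one_left := fun y => by
          show E.invFun ((1 : I) : ℝ) y = Kc.symm y
          rw [Set.Icc.coe_one, ← Diffeotopy.coe_stage_symm, hE1] }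
    -- the track of `i 0` under `F` stays in `range i`
    have hEinv : ∀ s, E.invFun s (i 0) ∈ range i := by
      intro s
      by_cases h0 : i 0 ∈ K₂
      · have hfix : ∀ x, x ∉ K₂ → E.invFun s x = x := fun x hx => by
          conv_lhs => rw [← hEK s x hx]
          exact E.invFun_toFun s x
        by_contra hmem
        have hnot : E.invFun s (i 0) ∉ K₂ := fun h => hmem (hK₂i h)
        have h2 : E.toFun s (E.invFun s (i 0)) = E.invFun s (i 0) := hEK s _ hnot
        rw [E.toFun_invFun] at h2
        exact hmem (h2 ▸ mem_range_self 0)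
      · have : E.invFun s (i 0) = i 0 := by
          conv_lhs => rw [← hEK s (i 0) h0]
          exact E.invFun_toFun s _
        rw [this]; exact mem_range_self 0
    set q : Path (g (i 0)) (i 0) := (Path.refl (i 0)).cast hKc0' rfl with hq
    have hrange : ∀ s, ((F.evalAt (i 0)).trans q) s ∈ range i := by
      intro s
      rw [Path.trans_apply]
      split_ifs with hs
      · exact hEinv _
      · show q _ ∈ range i
        rw [hq, Path.cast_coe, Path.refl_apply]
        exact mem_range_self 0
    have hq' : ((F.evalAt (i 0)).trans q).Homotopic (Path.refl (i 0)) :=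
      Path.Homotopic.refl_of_range_subset_range_disc hi ((F.evalAt (i 0)).trans q)
        (by rintro _ ⟨s, rfl⟩; exact hrange s)
    have hconj := Path.Homotopic.symm_trans_map_trans_of_homotopy F T q hq'
    have hTid : T.map (map_continuous (ContinuousMap.id M)) = T := by ext; rfl
    rw [hTid] at hconj
    have hcast := Path.Homotopic.symm_trans_trans_refl_cast hKc0' (T.map (map_continuous g))
    -- the new track, as a path, is the cast of `Kc⁻¹ ∘ T`
    have htrack : (D'.trackPath (i 0)).cast rfl h1'.symm =
        (T.map (map_continuous g)).cast hKc0'.symm hKc0'.symm := by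
      ext t
      rw [Path.cast_coe, Path.cast_coe, Diffeotopy.trackPath_apply, hD't, hKc0, Path.map_coe,
        comp_apply, hT, Path.cast_coe, Diffeotopy.trackPath_apply]
      rfl
    rw [htrack]
    exact (hcast.symm.trans hconj).trans hhom

/-! ### Loops missing the centre of a disc miss the whole disc, up to homotopy -/

omit [IsManifold (𝓡 n) ∞ M] in
/-- A compact set missing the centre of a disc misses a concentric closed subdisc. [folklore] -/
theorem exists_pos_disjoint_image_closedBall_of_notMem {i : 𝔼 n → M}
    (hi : Manifold.IsSmoothEmbedding 𝓘(ℝ, 𝔼 n) (𝓡 n) ∞ i) {C : Set M} (hC : IsCompact C)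
    (h0 : i 0 ∉ C) : ∃ r > (0 : ℝ), Disjoint C (i '' closedBall 0 r) := by
  have hcl : IsClosed (i ⁻¹' C) := hC.isClosed.preimage hi.contMDiff.continuous
  have h0' : (0 : 𝔼 n) ∉ i ⁻¹' C := h0
  obtain ⟨r, hr, hball⟩ := Metric.isOpen_iff.1 hcl.isOpen_compl 0 h0'
  refine ⟨r / 2, half_pos hr, Set.disjoint_left.2 ?_⟩
  rintro _ hzC ⟨y, hy, rfl⟩
  have hy' : y ∈ ball (0 : 𝔼 n) r := by
    rw [mem_ball_zero_iff]
    exact lt_of_le_of_lt (by simpa using hy) (half_lt_self hr)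
  exact hball hy' hzC

omit [IsManifold (𝓡 n) ∞ M] in
/-- **Loops missing the centre of a disc can be homotoped off the whole disc.**  Let
`i : ℝⁿ → M` be a disc, `γ` a path from `p` to `q` with `p, q ∉ range i` and `i 0 ∉ range γ`.
Then there is a path `γ'` from `p` to `q`, homotopic to `γ` rel end points, missing the closed
disc `i(B̄(0, 1))`, and such that every point off `range i` lies on `γ'` iff it lies on `γ`.
Proof: `γ` misses `i(B̄(0, r))` for some `r > 0`; with the ambient contraction `K`,
`K (i y) = i (r y)` (`exists_isCompactlyDiffeotopicToIdIn_apply_disc_eq_disc_smul`), take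
`γ' = K⁻¹ ∘ γ` and the homotopy `K_s⁻¹ ∘ γ`, which fixes `p`, `q`. [cite: HirschDT1976, Ch. 8 §3, Thm. 3.1] -/
theorem Path.exists_homotopic_disjoint_image_closedBall {i : 𝔼 n → M}
    (hi : Manifold.IsSmoothEmbedding 𝓘(ℝ, 𝔼 n) (𝓡 n) ∞ i) {p q : M} (γ : Path p q)
    (hp : p ∉ range i) (hq : q ∉ range i) (h0 : i 0 ∉ range γ) :
    ∃ γ' : Path p q, γ'.Homotopic γ ∧ Disjoint (range γ') (i '' closedBall 0 1) ∧
      ∀ z, z ∉ range i → (z ∈ range γ' ↔ z ∈ range γ) := by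
  obtain ⟨r, hr, hdisj⟩ :=
    exists_pos_disjoint_image_closedBall_of_notMem hi (isCompact_range γ.continuous) h0
  obtain ⟨Kc, hKcd, hKci⟩ :=
    exists_isCompactlyDiffeotopicToIdIn_apply_disc_eq_disc_smul hi hr (subset_refl (range i))
  obtain ⟨E, K₂, hK₂c, hK₂i, hE1, hEK⟩ := hKcd
  have hE1' : ∀ x, E.toFun 1 x = Kc x := fun x => by rw [← Diffeotopy.coe_stage, hE1]
  have hinvfix : ∀ s x, x ∉ range i → E.invFun s x = x := fun s x hx => by
    conv_lhs => rw [← hEK s x (fun h => hx (hK₂i h))]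
    exact E.invFun_toFun s x
  have hKcfix : ∀ x, x ∉ range i → Kc x = x := fun x hx => by
    rw [← hE1', hEK 1 x (fun h => hx (hK₂i h))]
  have hKcinv : ⇑Kc.symm = E.invFun 1 := by rw [← Diffeotopy.coe_stage_symm, hE1]
  have hsrc : Kc.symm p = p := by rw [hKcinv, hinvfix 1 p hp]
  have htgt : Kc.symm q = q := by rw [hKcinv, hinvfix 1 q hq]
  let γ' : Path p q :=
    { toFun := fun t => Kc.symm (γ t)
      continuous_toFun := Kc.symm.continuous.comp γ.continuous
      source' := by rw [γ.source, hsrc]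
      target' := by rw [γ.target, htgt] }
  have hγ' : ∀ t, γ' t = Kc.symm (γ t) := fun t => rfl
  refine ⟨γ', ?_, ?_, fun z hz => ?_⟩
  · refine Path.Homotopic.symm ⟨?_⟩
    exact
      { toFun := fun x => E.invFun x.1 (γ x.2)
        continuous_toFun := E.contMDiff_uncurry_invFun.continuous.comp
          ((continuous_subtype_val.comp continuous_fst).prodMk (γ.continuous.comp continuous_snd))
        map_zero_left := fun t => by
          show E.invFun ((0 : I) : ℝ) (γ t) = γ t
          rw [Set.Icc.coe_zero, E.invFun_zero]; rfl
        map_one_left := fun t => by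
          show E.invFun ((1 : I) : ℝ) (γ t) = γ' t
          rw [Set.Icc.coe_one, hγ', hKcinv]
        prop' := fun s t ht => by
          show E.invFun (s : ℝ) (γ t) = γ t
          simp only [mem_insert_iff, mem_singleton_iff] at ht
          rcases ht with rfl | rfl
          · rw [γ.source, hinvfix _ p hp]
          · rw [γ.target, hinvfix _ q hq] }
  · rw [Set.disjoint_left]
    rintro _ ⟨t, rfl⟩ ⟨y, hy, hyt⟩
    rw [hγ'] at hyt
    have h := congrArg Kc hyt
    rw [Kc.apply_symm_apply, hKci y (by simpa using hy)] at h
    refine Set.disjoint_left.1 hdisj ⟨t, rfl⟩ ⟨r • y, ?_, h⟩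
    rw [mem_closedBall, dist_zero_right, norm_smul, Real.norm_of_nonneg hr.le]
    have hy1 : ‖y‖ ≤ 1 := by simpa using hy
    calc r * ‖y‖ ≤ r * 1 := by gcongr
      _ = r := mul_one r
  · have hz' : Kc.symm z = z := by rw [hKcinv, hinvfix 1 z hz]
    constructor
    · rintro ⟨t, ht⟩
      rw [hγ'] at ht
      refine ⟨t, ?_⟩
      have h := congrArg Kc ht
      rwa [Kc.apply_symm_apply, hKcfix z hz] at h
    · rintro ⟨t, ht⟩
      exact ⟨t, by rw [hγ', ht, hz']⟩

end Disc

end Literature.Topology.FourManifolds
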